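import Literature.AlgebraicGeometry.Frobenioids.CdTransport
import Mathlib.Algebra.Ring.Divisibility.Basic
import HarnessLib

/-!
# Frobenioids I, Proposition 2.5 (iii), bracket "`C(d)` is a Frobenioid": transport along `Ψ`, part 2

Mochizuki, *The geometry of Frobenioids I: the general theory*, Kyushu J. Math. **62** (2008)
293–400, §2, Proposition 2.5 (iii), kurims text p. 49 [cite: MochizukiFrdI2008, Prop. 2.5(iii) p.49]:
"[which implies, in particular, that `C(d)`, equipped with the natural functor `C(d) → F_{d·Φ}`,
is a Frobenioid]".

Continuation of `CdTransport.lean` (transport of structure along the unit-linear Frobenius functor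
`Ψ : C ⥲ C(d)`, `δ` injective on each `Φ(A)`): the dictionary for OBJECTS and for the
divisor-valued invariants —
* `O^▷(A) ≅ O^▷(Ψ A)` (`endSubmonoidCdEquiv`), units `O^×(A) → O^×(Ψ A)` (`Ψ.mapIso`);
* isotropic objects, Frobenius-trivial objects and isotropic hulls correspond;
* `Div(Ψ φ) = δ_A(Div φ)` and `(Base(Ψ ψ)^*)⁻¹ Div(Ψ ψ) = δ_A((Base ψ^*)⁻¹ Div ψ)`, so that
  metric equivalence and the divisibilities of Def. 1.3 (iii)(d) correspond.
The clauses of Def. 1.3 are assembled in `CdIsFrobenioid.lean`.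

Provenance: typed/proved by abc-iut-L6-t9 (prover-abc-iut-L6-t9-g0-0; staged HOME/staging/L1/L6-t9/,
MANIFEST.txt, session ended 2026-08-25T23:52Z inviting any seat to file verbatim); filed verbatim by
abc-iut-w5-d248 as filer-of-record (L1-lead ruling R82 (4), 2026-08-26T00:16:47Z) after re-verification
against the current tree (only change: fully-qualified closing types where applicable, and this note).
-/

noncomputable section

namespace Literature.AlgebraicGeometry.Frobenioids

open CategoryTheory Opposite

universe w v v' u u'

namespace PreFrobenioid

variable {D : Type u} [Category.{v} D] {Φ : Dᵒᵖ ⥤ CommMonCat.{w}}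
  {C : Type u'} [Category.{v'} C] {F : C ⥤ ElemFrobenioid Φ}

namespace CharacteristicSplitting

variable (hF : IsFrobenioid F) (τ : CharacteristicSplitting F) (hmt : IsOfType (IsMetricallyTrivial F))
  (haa : IsOfType (IsAutAmple F)) (δ : Φ ⟶ Φ) (hnorm : IsOfType (IsFrobeniusNormalized F))

set_option quotPrecheck false in
/-- The unit-linear Frobenius functor `Ψ : C → C(d)` as a functor (notation local to this file). -/
local notation "𝔊" => (unitLinearFrobeniusData hF τ hmt haa δ hnorm).functor

include hF τ hmt haa δ hnorm

/-! ### `O^▷` and `O^×` -/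

/-- `Ψ(α)` is a base-identity endomorphism iff `α` is. [cite: MochizukiFrdI2008, Prop. 2.5(iii) p.49] -/
theorem isBaseIdentity_cdFunctor_map_iff {A : C} (α : A ⟶ A) :
    IsBaseIdentity (cdToElem F δ) ((𝔊).map α) ↔ IsBaseIdentity F α := by
  show Base F (unitLinearMap hF τ hmt haa δ hnorm α) = 𝟙 _ ↔ Base F α = 𝟙 _
  rw [base_unitLinearMap]

/-- **`O^▷(A) ≅ O^▷(Ψ A)`** via `Ψ` (a fully faithful functor preserving `Base` and `deg_Fr`).
[cite: MochizukiFrdI2008, Prop. 2.5(iii) p.49] -/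
def endSubmonoidCdEquiv (hδ : ∀ A : Dᵒᵖ, Function.Injective (δ.app A).hom) (A : C) :
    endSubmonoid F A ≃* endSubmonoid (cdToElem F δ) ((𝔊).obj A) :=
  haveI := unitLinearFrobeniusData_isEquivalence hF τ hmt haa δ hnorm hδ
  { toFun := fun a => ⟨(𝔊).map a.1,
      (isBaseIdentity_cdFunctor_map_iff hF τ hmt haa δ hnorm _).mpr a.2.1,
      (isLinear_cdFunctor_map_iff hF τ hmt haa δ hnorm _).mpr a.2.2⟩
    invFun := fun b => ⟨(𝔊).preimage b.1,
      (isBaseIdentity_cdFunctor_map_iff hF τ hmt haa δ hnorm _).mp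
        (by rw [Functor.map_preimage]; exact b.2.1),
      (isLinear_cdFunctor_map_iff hF τ hmt haa δ hnorm _).mp
        (by rw [Functor.map_preimage]; exact b.2.2)⟩
    left_inv := fun a => Subtype.ext ((𝔊).preimage_map a.1)
    right_inv := fun b => Subtype.ext ((𝔊).map_preimage b.1)
    map_mul' := fun a b => Subtype.ext ((𝔊).map_comp b.1 a.1) }

/-- The underlying arrow of `endSubmonoidCdEquiv a` is `Ψ(a)`. [cite: MochizukiFrdI2008, Prop. 2.5(iii) p.49] -/
theorem endSubmonoidCdEquiv_coe (hδ : ∀ A : Dᵒᵖ, Function.Injective (δ.app A).hom) {A : C}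
    (a : endSubmonoid F A) :
    ((endSubmonoidCdEquiv hF τ hmt haa δ hnorm hδ A a).1 : (𝔊).obj A ⟶ (𝔊).obj A) = (𝔊).map a.1 :=
  rfl

/-- The underlying arrow of `b ∈ O^▷(Ψ A)` is `Ψ` of that of its preimage.
[cite: MochizukiFrdI2008, Prop. 2.5(iii) p.49] -/
theorem map_endSubmonoidCdEquiv_symm_coe (hδ : ∀ A : Dᵒᵖ, Function.Injective (δ.app A).hom) {A : C}
    (b : endSubmonoid (cdToElem F δ) ((𝔊).obj A)) :
    (𝔊).map (((endSubmonoidCdEquiv hF τ hmt haa δ hnorm hδ A).symm b).1 : A ⟶ A) = b.1 :=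
  congrArg Subtype.val ((endSubmonoidCdEquiv hF τ hmt haa δ hnorm hδ A).apply_symm_apply b)

/-- A unit of `O^▷(A)` goes to a unit of `O^▷(Ψ A)`: `Ψ.mapIso`. [cite: MochizukiFrdI2008, Prop. 2.5(iii) p.49] -/
theorem mapIso_mem_unitsSubgroup {A : C} {α : A ≅ A} (hα : α ∈ unitsSubgroup F A) :
    (𝔊).mapIso α ∈ unitsSubgroup (cdToElem F δ) ((𝔊).obj A) :=
  ⟨(isBaseIdentity_cdFunctor_map_iff hF τ hmt haa δ hnorm _).mpr hα.1,
    (isLinear_cdFunctor_map_iff hF τ hmt haa δ hnorm _).mpr hα.2⟩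

/-! ### Objects: isotropic, Frobenius-trivial, isotropic hulls -/

/-- Isotropic: `Ψ A` iff `A`. [cite: MochizukiFrdI2008, Prop. 2.5(iii) p.49] -/
theorem isIsotropic_cdFunctor_obj_iff (hδ : ∀ A : Dᵒᵖ, Function.Injective (δ.app A).hom) (A : C) :
    IsIsotropic (cdToElem F δ) ((𝔊).obj A) ↔ IsIsotropic F A := by
  haveI := unitLinearFrobeniusData_isEquivalence hF τ hmt haa δ hnorm hδ
  constructor
  · intro h B ψ hψi hψp
    exact (isIso_cdFunctor_map_iff hF τ hmt haa δ hnorm hδ ψ).mp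
      (h ((𝔊).map ψ) ((isIsometry_cdFunctor_map_iff hF τ hmt haa δ hnorm hδ ψ).mpr hψi)
        ((isPreStep_cdFunctor_map_iff hF τ hmt haa δ hnorm ψ).mpr hψp))
  · intro h B' ψ' hψi hψp
    obtain ⟨B, rfl⟩ : ∃ B : C, (𝔊).obj B = B' := ⟨B'.obj, rfl⟩
    obtain ⟨ψ, rfl⟩ := (𝔊).map_surjective ψ'
    exact (isIso_cdFunctor_map_iff hF τ hmt haa δ hnorm hδ ψ).mpr
      (h ψ ((isIsometry_cdFunctor_map_iff hF τ hmt haa δ hnorm hδ ψ).mp hψi)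
        ((isPreStep_cdFunctor_map_iff hF τ hmt haa δ hnorm ψ).mp hψp))

/-- Frobenius-trivial objects go to Frobenius-trivial objects (`ζ ↦ Ψ ∘ ζ`).
[cite: MochizukiFrdI2008, Prop. 2.5(iii) p.49] -/
theorem isFrobeniusTrivial_cdFunctor_obj (hδ : ∀ A : Dᵒᵖ, Function.Injective (δ.app A).hom) {A : C}
    (hA : IsFrobeniusTrivial F A) : IsFrobeniusTrivial (cdToElem F δ) ((𝔊).obj A) := by
  obtain ⟨ζ, hζ⟩ := hA
  let ζ' : ℕ+ →* End ((𝔊).obj A) :=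
    { toFun := fun n => (𝔊).map (ζ n)
      map_one' := by rw [map_one]; exact (𝔊).map_id A
      map_mul' := fun m n => by rw [map_mul]; exact (𝔊).map_comp (ζ n) (ζ m) }
  refine ⟨ζ', fun n => ⟨?_, ?_, ?_⟩⟩
  · exact (degFr_cdFunctor_map hF τ hmt haa δ hnorm (ζ n : A ⟶ A)).trans (hζ n).1
  · exact (isBaseIdentity_cdFunctor_map_iff hF τ hmt haa δ hnorm _).mpr (hζ n).2.1
  · exact (isFrobeniusType_cdFunctor_map_iff hF τ hmt haa δ hnorm hδ _).mpr (hζ n).2.2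

/-- Isotropic hulls go to isotropic hulls. [cite: MochizukiFrdI2008, Prop. 2.5(iii) p.49] -/
theorem isIsotropicHull_cdFunctor_map (hδ : ∀ A : Dᵒᵖ, Function.Injective (δ.app A).hom) {A B : C}
    {φ : A ⟶ B} (hφ : IsIsotropicHull F φ) : IsIsotropicHull (cdToElem F δ) ((𝔊).map φ) := by
  haveI := unitLinearFrobeniusData_isEquivalence hF τ hmt haa δ hnorm hδ
  refine ⟨(isIsometry_cdFunctor_map_iff hF τ hmt haa δ hnorm hδ φ).mpr hφ.1,
    (isPreStep_cdFunctor_map_iff hF τ hmt haa δ hnorm φ).mpr hφ.2.1,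
    (isIsotropic_cdFunctor_obj_iff hF τ hmt haa δ hnorm hδ B).mpr hφ.2.2.1, fun C' γ' hC' => ?_⟩
  obtain ⟨X, rfl⟩ : ∃ X : C, (𝔊).obj X = C' := ⟨C'.obj, rfl⟩
  obtain ⟨γ, rfl⟩ := (𝔊).map_surjective γ'
  obtain ⟨β, hβ, hβu⟩ :=
    hφ.2.2.2 γ ((isIsotropic_cdFunctor_obj_iff hF τ hmt haa δ hnorm hδ X).mp hC')
  refine ⟨(𝔊).map β, ?_, fun β' hβ' => ?_⟩
  · show (𝔊).map φ ≫ (𝔊).map β = (𝔊).map γ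
    rw [← Functor.map_comp, hβ]
  obtain ⟨β₀, rfl⟩ := (𝔊).map_surjective β'
  rw [hβu β₀ ((𝔊).map_injective (by rw [Functor.map_comp]; exact hβ'))]

/-! ### Divisors -/

/-- Metric equivalence: `Ψ φ, Ψ ψ` iff `φ, ψ`. [cite: MochizukiFrdI2008, Prop. 2.5(iii) p.49] -/
theorem metricallyEquivalent_cdFunctor_map_iff (hδ : ∀ A : Dᵒᵖ, Function.Injective (δ.app A).hom)
    {A B : C} (φ ψ : A ⟶ B) :
    MetricallyEquivalent (cdToElem F δ) ((𝔊).map φ) ((𝔊).map ψ) ↔ MetricallyEquivalent F φ ψ := by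
  show Div (cdToElem F δ) ((𝔊).map φ) = Div (cdToElem F δ) ((𝔊).map ψ) ↔ Div F φ = Div F ψ
  rw [div_cdFunctor_map hF τ hmt haa δ hnorm hδ, div_cdFunctor_map hF τ hmt haa δ hnorm hδ]
  exact (imageEquiv δ hδ _).injective.eq_iff

/-- Divisibility of divisors: `Div(Ψ φ) ∣ Div(Ψ ψ)` iff `Div φ ∣ Div ψ`.
[cite: MochizukiFrdI2008, Prop. 2.5(iii) p.49] -/
theorem div_cdFunctor_map_dvd_iff (hδ : ∀ A : Dᵒᵖ, Function.Injective (δ.app A).hom) {A B B' : C}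
    (φ : A ⟶ B) (ψ : A ⟶ B') :
    Div (cdToElem F δ) ((𝔊).map φ) ∣ Div (cdToElem F δ) ((𝔊).map ψ) ↔ Div F φ ∣ Div F ψ := by
  rw [div_cdFunctor_map hF τ hmt haa δ hnorm hδ, div_cdFunctor_map hF τ hmt haa δ hnorm hδ]
  show imageEquiv δ hδ (op (baseObj F A)) (Div F φ) ∣ imageEquiv δ hδ (op (baseObj F A)) (Div F ψ) ↔ _
  exact map_dvd_iff _

/-- `(Base(Ψ ψ)^*)⁻¹ Div(Ψ ψ) = δ((Base ψ^*)⁻¹ Div ψ)` for a base-isomorphism `ψ` (underlying elements).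
[cite: MochizukiFrdI2008, Prop. 2.5(iii) p.49] -/
theorem coe_invDiv_cdFunctor_map {A B : C} (ψ : B ⟶ A) (h : IsBaseIso F ψ)
    (h' : IsBaseIso (cdToElem F δ) ((𝔊).map ψ)) :
    (invDiv (cdToElem F δ) ((𝔊).map ψ) h').1 = (δ.app (op (baseObj F A))).hom (invDiv F ψ h) := by
  haveI : IsIso (Base F ψ) := h
  apply pull_injective_of_isIso Φ (Base F ψ)
  rw [← end_app_pull, pull_invDiv ψ h, ← div_unitLinearMap hF τ hmt haa δ hnorm ψ]
  have h1 := congrArg Subtype.val (pull_invDiv ((𝔊).map ψ) h')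
  rw [coe_pull_imageMonoid] at h1
  have hb : Base (cdToElem F δ) ((𝔊).map ψ) = Base F ψ := base_unitLinearMap hF τ hmt haa δ hnorm ψ
  rw [hb] at h1
  exact h1

/-- `(Base(Ψ ψ)^*)⁻¹ Div(Ψ ψ) = δ_A((Base ψ^*)⁻¹ Div ψ)`. [cite: MochizukiFrdI2008, Prop. 2.5(iii) p.49] -/
theorem invDiv_cdFunctor_map (hδ : ∀ A : Dᵒᵖ, Function.Injective (δ.app A).hom) {A B : C} (ψ : B ⟶ A)
    (h : IsBaseIso F ψ) (h' : IsBaseIso (cdToElem F δ) ((𝔊).map ψ)) :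
    invDiv (cdToElem F δ) ((𝔊).map ψ) h' = imageEquiv δ hδ _ (invDiv F ψ h) :=
  Subtype.ext (coe_invDiv_cdFunctor_map hF τ hmt haa δ hnorm ψ h h')

/-- Divisibility of the `invDiv`s: in `C(d)` iff in `C`. [cite: MochizukiFrdI2008, Prop. 2.5(iii) p.49] -/
theorem invDiv_cdFunctor_map_dvd_iff (hδ : ∀ A : Dᵒᵖ, Function.Injective (δ.app A).hom) {A B B' : C}
    (ψ : B ⟶ A) (ψ' : B' ⟶ A) (h : IsBaseIso F ψ) (hh : IsBaseIso F ψ')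
    (h₁ : IsBaseIso (cdToElem F δ) ((𝔊).map ψ)) (h₁' : IsBaseIso (cdToElem F δ) ((𝔊).map ψ')) :
    invDiv (cdToElem F δ) ((𝔊).map ψ') h₁' ∣ invDiv (cdToElem F δ) ((𝔊).map ψ) h₁ ↔
      invDiv F ψ' hh ∣ invDiv F ψ h := by
  rw [invDiv_cdFunctor_map hF τ hmt haa δ hnorm hδ ψ h, invDiv_cdFunctor_map hF τ hmt haa δ hnorm hδ ψ' hh]
  show imageEquiv δ hδ (op (baseObj F A)) (invDiv F ψ' hh) ∣
    imageEquiv δ hδ (op (baseObj F A)) (invDiv F ψ h) ↔ _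
  exact map_dvd_iff _

end CharacteristicSplitting

end PreFrobenioid

end Literature.AlgebraicGeometry.Frobenioids
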